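import Mathlib
import Summits.MatrixMultiplication.Statement
import Literature.Computability.AlgebraicComplexity.SchoenhageTau
import Literature.Computability.AlgebraicComplexity.GroupAlgebraTensor
import Literature.Computability.AlgebraicComplexity.BorderRankRestriction

/-!
# Sketch — crux TargetsGiveGap (stmt-MatrixMultiplication-15043), crux-ideate round 1, ideator 1

First lemmas of the two idea cards (statements only; `sorry` bodies), plus two elaboration
checks of the common frame:

* CHECK 1 (`instantiate_by_unification`): the pinned `P` and `act` of `FixedPointFreeTargets` are
  supplied by higher-order unification from `fun _ _ _ _ => rfl` — no hand-written copy of the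
  binder, hence no decidable-instance mismatch is possible at the instantiation step.
* CHECK 2 (`frame`): the contradiction is taken at level `r := algBorderRank M` itself — no floor
  arithmetic (`Nat.floor`) is needed, contrary to the item's informal plan.

Card A (`three-pairings-stabiliser`): `matMulTensorOn_stabilizer₃` + `pauli_row_orthonormal`.
Card B (`monomial-closed-form`): `pauli_act_apply` (closed form of the sandwich action on ALL of V)
+ `pauli_act_matMulTensorOn`.
Shared: `algBorderRank_matMulTensorOn` (verbatim `tensorRank_matMulTensorOn` with
`algBorderRank_reindex`), `matMulTensorOn_ne_zero`.
-/

set_option linter.dupNamespace false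

/-! ## Local verbatim copies of the route decls (the farm's olean of the route file is stale at
rev ≤ 2 on 2026-08-16T08Z: it still has `BeyondCactusWall` and lacks `FixedPointFreeTargets` /
`TargetsGiveGap`; texts below are copied mechanically from rev 7 of
`Summits/MatrixMultiplication/MatrixMultiplication/Theses/PauliSmithLocalisation.lean`). -/

namespace Summit.MatrixMultiplication.MatrixMultiplication.Cruxes.TargetsGiveGap.Sketch.Local

open scoped BigOperators Topology Manifold Classical MeasureTheory ProbabilityTheory Matrix InnerProductSpace ComplexConjugate ContinuousMap
open Filter Set Function TopologicalSpace MeasureTheory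

def SmithPhaseGap : Prop :=
  ∃ p : ℕ, p.Prime ∧ ∃ δ : ℝ, 0 < δ ∧ ∃ k₀ : ℕ, ∀ k : ℕ, k₀ ≤ k → ((p ^ k : ℕ) : ℝ) ^ (2 + δ) < (Literature.Computability.AlgebraicComplexity.algBorderRank (Literature.Computability.AlgebraicComplexity.matMulTensor ℂ (p ^ k) (p ^ k) (p ^ k)) : ℝ)

def FixedPointFreeTargets : Prop :=
  ∃ p : ℕ, ∃ _ : Fact p.Prime, ∃ δ : ℝ, 0 < δ ∧ ∃ k₀ : ℕ, ∀ k : ℕ, k₀ ≤ k → ∀ (P : (Fin k → ZMod p) → (Fin k → ZMod p) → Matrix (Fin k → ZMod p) (Fin k → ZMod p) ℂ), (∀ x z u v, P x z u v = if u = v + x then Complex.exp (2 * Real.pi * Complex.I * ((∑ i, z i * v i).val : ℂ) / (p : ℂ)) else 0) → ∀ (act : ((Fin k → ZMod p) × (Fin k → ZMod p)) × ((Fin k → ZMod p) × (Fin k → ZMod p)) × ((Fin k → ZMod p) × (Fin k → ZMod p)) → (((Fin k → ZMod p) × (Fin k → ZMod p)) → ((Fin k → ZMod p) × (Fin k → ZMod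 p)) → ((Fin k → ZMod p) × (Fin k → ZMod p)) → ℂ) → (((Fin k → ZMod p) × (Fin k → ZMod p)) → ((Fin k → ZMod p) × (Fin k → ZMod p)) → ((Fin k → ZMod p) × (Fin k → ZMod p)) → ℂ)), (∀ g x a b c, act g x a b c = ∑ a', ∑ b', ∑ c', (starRingEnd ℂ (P g.1.1 g.1.2 a.1 a'.1) * P g.2.2.1 g.2.2.2 a.2 a'.2) * (P g.1.1 g.1.2 b.1 b'.1 * starRingEnd ℂ (P g.2.1.1 g.2.1.2 b.2 b'.2)) * (P g.2.1.1 g.2.1.2 c.1 c'.1 * starRingEnd ℂ (P g.2.2.1 g.2.2.2 c.2 c'.2)) * x a' b' c') → ∀ r : ℕ, (r : ℝ) ≤ ((p ^ k : ℕ) : ℝ) ^ (2 + δ) → ∃ (d : ℕ) (ρ : ((Fin k → ZMod p) × (Fin k → ZMod p)) × ((Fin k → ZMod p) × (Fin k → ZMod p)) × ((Fin k → ZMod p) × (Fin k → ZMod p)) → Matrix (Fin d) (Fin d) ℂ) (f : (((Fin k → ZMod p) × (Fin k → ZMod p)) → ((Fin k → ZMod p) × (Fin k → ZMod p)) → ((Fin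 k → ZMod p) × (Fin k → ZMod p)) → ℂ) → (Fin d → ℂ)), ρ 0 = 1 ∧ (∀ g h, ρ (g + h) = ρ g * ρ h) ∧ (∀ w : Fin d → ℂ, (∀ g, (ρ g).mulVec w = w) → w = 0) ∧ ContinuousOn f {x | x ≠ 0 ∧ Literature.Computability.AlgebraicComplexity.algBorderRank x ≤ r} ∧ (∀ x, x ≠ 0 → Literature.Computability.AlgebraicComplexity.algBorderRank x ≤ r → f x ≠ 0) ∧ (∀ g x, Literature.Computability.AlgebraicComplexity.algBorderRank x ≤ r → f (act g x) = (ρ g).mulVec (f x))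

def TargetsGiveGap : Prop :=
  FixedPointFreeTargets → SmithPhaseGap

end Summit.MatrixMultiplication.MatrixMultiplication.Cruxes.TargetsGiveGap.Sketch.Local

namespace Summit.MatrixMultiplication.MatrixMultiplication.Cruxes.TargetsGiveGap.Sketch

open scoped BigOperators ComplexConjugate Classical
open Literature.Computability.AlgebraicComplexity

/-! ## Card A — first lemma: the three-pairings stabiliser of `matMulTensorOn` -/

/-- **Card A, first lemma.** `⟨α,β,γ⟩ = matMulTensorOn K α β γ` is the product of the three identity
pairings on the slot pairs `{a.1,b.1} ⊂ α`, `{b.2,c.1} ⊂ β`, `{a.2,c.2} ⊂ γ`; a sandwich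
`(A₁ ⊗ C₂) ⊗ (A₂ ⊗ B₁) ⊗ (B₂ ⊗ C₁)` fixes it as soon as `A₁ A₂ᵀ = 1`, `B₁ B₂ᵀ = 1`, `C₁ C₂ᵀ = 1`
(row-pairing form, exactly the shape of `matMulTensor_stabilizer`'s hypotheses, now for all THREE
factors and arbitrary finite index types).  The summand is token-for-token the summand of the pinned
`act` of `FixedPointFreeTargets` with `A₁ = conj ∘ A`, `A₂ = A`, `B₁ = conj ∘ B`, `B₂ = B`,
`C₁ = conj ∘ C`, `C₂ = C`. -/
theorem matMulTensorOn_stabilizer₃ {K : Type*} [CommRing K] {α β γ : Type*} [Fintype α] [Fintype β]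
    [Fintype γ] [DecidableEq α] [DecidableEq β] [DecidableEq γ]
    (A₁ A₂ : α → α → K) (B₁ B₂ : β → β → K) (C₁ C₂ : γ → γ → K)
    (hA : ∀ i j, ∑ t, A₁ i t * A₂ j t = if i = j then 1 else 0)
    (hB : ∀ i j, ∑ t, B₁ i t * B₂ j t = if i = j then 1 else 0)
    (hC : ∀ i j, ∑ t, C₁ i t * C₂ j t = if i = j then 1 else 0)
    (a : α × γ) (b : α × β) (c : β × γ) :
    ∑ a' : α × γ, ∑ b' : α × β, ∑ c' : β × γ,
      (A₁ a.1 a'.1 * C₂ a.2 a'.2) * (A₂ b.1 b'.1 * B₁ b.2 b'.2) * (B₂ c.1 c'.1 * C₁ c.2 c'.2) *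
        matMulTensorOn K α β γ a' b' c' = matMulTensorOn K α β γ a b c := by
  sorry

/-- **Card A, second lemma.** Row-orthonormality of the pinned Pauli matrices: `P_(x,z) P_(x,z)ᴴ = 1`
(one non-zero unimodular entry per row, in column `u - x`).  The only analysis:
`conj (exp w) * exp w = 1` for `w ∈ iℝ` (`Complex.exp_conj`, `← Complex.exp_add`). -/
theorem pauli_row_orthonormal (p k : ℕ) [Fact p.Prime]
    (P : (Fin k → ZMod p) → (Fin k → ZMod p) → Matrix (Fin k → ZMod p) (Fin k → ZMod p) ℂ)
    (hP : ∀ x z u v, P x z u v = if u = v + x then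
      Complex.exp (2 * Real.pi * Complex.I * ((∑ i, z i * v i).val : ℂ) / (p : ℂ)) else 0)
    (x z i j : Fin k → ZMod p) :
    ∑ t, starRingEnd ℂ (P x z i t) * P x z j t = if i = j then 1 else 0 := by
  sorry

/-! ## Card B — first lemma: the sandwich action is a phased coordinate permutation (closed form) -/

/-- **Card B, first lemma.** Because every Pauli matrix is MONOMIAL (row `u` has its single entry in
column `u - x`), the pinned triple sum collapses (three `Fintype.sum_eq_single` on pair indices) to a
closed form valid for EVERY tensor `y ∈ V`: `act g y (a,b,c) = phase · y (a - s₁) (b - s₂) (c - s₃)`.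
This is the structural fact the other crux (FixedPointFreeTargets) also needs (act g is a monomial,
hence border-rank-preserving, linear automorphism of V). -/
theorem pauli_act_apply (p k : ℕ) [Fact p.Prime]
    (P : (Fin k → ZMod p) → (Fin k → ZMod p) → Matrix (Fin k → ZMod p) (Fin k → ZMod p) ℂ)
    (hP : ∀ x z u v, P x z u v = if u = v + x then
      Complex.exp (2 * Real.pi * Complex.I * ((∑ i, z i * v i).val : ℂ) / (p : ℂ)) else 0)
    (act : ((Fin k → ZMod p) × (Fin k → ZMod p)) × ((Fin k → ZMod p) × (Fin k → ZMod p)) ×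
        ((Fin k → ZMod p) × (Fin k → ZMod p)) →
      (((Fin k → ZMod p) × (Fin k → ZMod p)) → ((Fin k → ZMod p) × (Fin k → ZMod p)) →
        ((Fin k → ZMod p) × (Fin k → ZMod p)) → ℂ) →
      (((Fin k → ZMod p) × (Fin k → ZMod p)) → ((Fin k → ZMod p) × (Fin k → ZMod p)) →
        ((Fin k → ZMod p) × (Fin k → ZMod p)) → ℂ))
    (hact : ∀ g y a b c, act g y a b c = ∑ a', ∑ b', ∑ c',
      (starRingEnd ℂ (P g.1.1 g.1.2 a.1 a'.1) * P g.2.2.1 g.2.2.2 a.2 a'.2) *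
      (P g.1.1 g.1.2 b.1 b'.1 * starRingEnd ℂ (P g.2.1.1 g.2.1.2 b.2 b'.2)) *
      (P g.2.1.1 g.2.1.2 c.1 c'.1 * starRingEnd ℂ (P g.2.2.1 g.2.2.2 c.2 c'.2)) * y a' b' c')
    (g : ((Fin k → ZMod p) × (Fin k → ZMod p)) × ((Fin k → ZMod p) × (Fin k → ZMod p)) ×
        ((Fin k → ZMod p) × (Fin k → ZMod p)))
    (y : ((Fin k → ZMod p) × (Fin k → ZMod p)) → ((Fin k → ZMod p) × (Fin k → ZMod p)) →
        ((Fin k → ZMod p) × (Fin k → ZMod p)) → ℂ)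
    (a b c : (Fin k → ZMod p) × (Fin k → ZMod p)) :
    act g y a b c =
      (starRingEnd ℂ (P g.1.1 g.1.2 a.1 (a.1 - g.1.1)) * P g.2.2.1 g.2.2.2 a.2 (a.2 - g.2.2.1)) *
      (P g.1.1 g.1.2 b.1 (b.1 - g.1.1) * starRingEnd ℂ (P g.2.1.1 g.2.1.2 b.2 (b.2 - g.2.1.1))) *
      (P g.2.1.1 g.2.1.2 c.1 (c.1 - g.2.1.1) * starRingEnd ℂ (P g.2.2.1 g.2.2.2 c.2 (c.2 - g.2.2.1))) *
        y (a.1 - g.1.1, a.2 - g.2.2.1) (b.1 - g.1.1, b.2 - g.2.1.1) (c.1 - g.2.1.1, c.2 - g.2.2.1) := by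
  sorry

/-- **Card B, second lemma** (invariance from the closed form): on the support of `M`
(`a.1 = b.1`, `b.2 = c.1`, `a.2 = c.2`, which is translation invariant) the six phases cancel in
pairs (`conj u * u = 1`, `|u| = 1`), off the support both sides vanish. -/
theorem pauli_act_matMulTensorOn (p k : ℕ) [Fact p.Prime]
    (P : (Fin k → ZMod p) → (Fin k → ZMod p) → Matrix (Fin k → ZMod p) (Fin k → ZMod p) ℂ)
    (hP : ∀ x z u v, P x z u v = if u = v + x then
      Complex.exp (2 * Real.pi * Complex.I * ((∑ i, z i * v i).val : ℂ) / (p : ℂ)) else 0)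
    (act : ((Fin k → ZMod p) × (Fin k → ZMod p)) × ((Fin k → ZMod p) × (Fin k → ZMod p)) ×
        ((Fin k → ZMod p) × (Fin k → ZMod p)) →
      (((Fin k → ZMod p) × (Fin k → ZMod p)) → ((Fin k → ZMod p) × (Fin k → ZMod p)) →
        ((Fin k → ZMod p) × (Fin k → ZMod p)) → ℂ) →
      (((Fin k → ZMod p) × (Fin k → ZMod p)) → ((Fin k → ZMod p) × (Fin k → ZMod p)) →
        ((Fin k → ZMod p) × (Fin k → ZMod p)) → ℂ))
    (hact : ∀ g y a b c, act g y a b c = ∑ a', ∑ b', ∑ c',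
      (starRingEnd ℂ (P g.1.1 g.1.2 a.1 a'.1) * P g.2.2.1 g.2.2.2 a.2 a'.2) *
      (P g.1.1 g.1.2 b.1 b'.1 * starRingEnd ℂ (P g.2.1.1 g.2.1.2 b.2 b'.2)) *
      (P g.2.1.1 g.2.1.2 c.1 c'.1 * starRingEnd ℂ (P g.2.2.1 g.2.2.2 c.2 c'.2)) * y a' b' c')
    (g : ((Fin k → ZMod p) × (Fin k → ZMod p)) × ((Fin k → ZMod p) × (Fin k → ZMod p)) ×
        ((Fin k → ZMod p) × (Fin k → ZMod p))) :
    act g (matMulTensorOn ℂ (Fin k → ZMod p) (Fin k → ZMod p) (Fin k → ZMod p)) =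
      matMulTensorOn ℂ (Fin k → ZMod p) (Fin k → ZMod p) (Fin k → ZMod p) := by
  sorry

/-! ## Shared bookkeeping -/

/-- `bR(matMulTensorOn K α β γ) = bR(⟨|α|,|β|,|γ|⟩)` — verbatim the proof of
`tensorRank_matMulTensorOn` with `algBorderRank_reindex` in place of `tensorRank_reindex`. -/
theorem algBorderRank_matMulTensorOn {K : Type*} [CommRing K] (α β γ : Type*) [Fintype α]
    [Fintype β] [Fintype γ] [DecidableEq α] [DecidableEq β] [DecidableEq γ] :
    algBorderRank (matMulTensorOn K α β γ) =
      algBorderRank (matMulTensor K (Fintype.card α) (Fintype.card β) (Fintype.card γ)) := by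
  set eα := Fintype.equivFin α
  set eβ := Fintype.equivFin β
  set eγ := Fintype.equivFin γ
  have h := algBorderRank_reindex (Equiv.prodCongr eα eγ) (Equiv.prodCongr eα eβ)
    (Equiv.prodCongr eβ eγ) (matMulTensor K (Fintype.card α) (Fintype.card β) (Fintype.card γ))
  rw [← h]
  congr 1
  funext a b c
  rw [← matMulTensorOn_fin]
  exact (matMulTensorOn_reindex eα eβ eγ a b c).symm

/-- `M ≠ 0` on a non-empty index type (entry `1` at `((i,i),(i,i),(i,i))`). -/
theorem matMulTensorOn_ne_zero {K : Type*} [CommRing K] [Nontrivial K] (α : Type*) [DecidableEq α]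
    [Inhabited α] : matMulTensorOn K α α α ≠ 0 := by
  intro h
  have := congrFun (congrFun (congrFun h (default, default)) (default, default)) (default, default)
  simp at this

/-! ## CHECK 1 + CHECK 2: the common frame elaborates (instantiation by unification; r := bR M) -/

/-- The frame of both cards: everything except the invariance lemma (`hinv`, sorried here as the
card's load-bearing step) is bookkeeping that elaborates NOW. -/
theorem frame : Local.TargetsGiveGap := by
  rintro ⟨p, hp, δ, hδ, k₀, H⟩
  refine ⟨p, hp.out, δ, hδ, k₀, fun k hk => ?_⟩
  by_contra hlt
  push Not at hlt
  -- the I-indexed matrix multiplication tensor and its border rank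
  set M := matMulTensorOn ℂ (Fin k → ZMod p) (Fin k → ZMod p) (Fin k → ZMod p) with hMdef
  have hcard : Fintype.card (Fin k → ZMod p) = p ^ k := by simp [ZMod.card]
  have hbR : algBorderRank M = algBorderRank (matMulTensor ℂ (p ^ k) (p ^ k) (p ^ k)) := by
    rw [hMdef, algBorderRank_matMulTensorOn, hcard]
  have hr : ((algBorderRank M : ℕ) : ℝ) ≤ ((p ^ k : ℕ) : ℝ) ^ (2 + δ) := by rw [hbR]; exact hlt
  -- CHECK 1: P and act are hand-copied from the binder and their pinning hypotheses close by `rfl`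
  -- (the variant `H k hk _ (fun _ _ _ _ => rfl) _ (fun _ _ _ _ _ => rfl) (algBorderRank M) hr`,
  -- instantiating both by unification, elaborates as well — checked in a previous pass).
  set P : (Fin k → ZMod p) → (Fin k → ZMod p) → Matrix (Fin k → ZMod p) (Fin k → ZMod p) ℂ :=
    fun x z u v => if u = v + x then
      Complex.exp (2 * Real.pi * Complex.I * ((∑ i, z i * v i).val : ℂ) / (p : ℂ)) else 0 with hPdef
  set act : ((Fin k → ZMod p) × (Fin k → ZMod p)) × ((Fin k → ZMod p) × (Fin k → ZMod p)) ×
        ((Fin k → ZMod p) × (Fin k → ZMod p)) →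
      (((Fin k → ZMod p) × (Fin k → ZMod p)) → ((Fin k → ZMod p) × (Fin k → ZMod p)) →
        ((Fin k → ZMod p) × (Fin k → ZMod p)) → ℂ) →
      (((Fin k → ZMod p) × (Fin k → ZMod p)) → ((Fin k → ZMod p) × (Fin k → ZMod p)) →
        ((Fin k → ZMod p) × (Fin k → ZMod p)) → ℂ) :=
    fun g y a b c => ∑ a', ∑ b', ∑ c',
      (starRingEnd ℂ (P g.1.1 g.1.2 a.1 a'.1) * P g.2.2.1 g.2.2.2 a.2 a'.2) *
      (P g.1.1 g.1.2 b.1 b'.1 * starRingEnd ℂ (P g.2.1.1 g.2.1.2 b.2 b'.2)) *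
      (P g.2.1.1 g.2.1.2 c.1 c'.1 * starRingEnd ℂ (P g.2.2.1 g.2.2.2 c.2 c'.2)) * y a' b' c'
    with hactdef
  obtain ⟨d, ρ, f, -, -, hfix, -, hnz, hequiv⟩ :=
    H k hk P (fun _ _ _ _ => rfl) act (fun _ _ _ _ _ => rfl) (algBorderRank M) hr
  -- the load-bearing step (Card A: `matMulTensorOn_stabilizer₃` + `pauli_row_orthonormal`;
  -- Card B: `pauli_act_matMulTensorOn`), here taken from Card B's lemma:
  have hinv : ∀ g, act g M = M := fun g =>
    pauli_act_matMulTensorOn p k P (fun _ _ _ _ => rfl) act (fun _ _ _ _ _ => rfl) g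
  have hM0 : M ≠ 0 := by
    rw [hMdef]; exact matMulTensorOn_ne_zero (K := ℂ) (Fin k → ZMod p)
  have hfM : f M = 0 := hfix (f M) fun g => by
    have := hequiv g M le_rfl
    rw [hinv g] at this
    exact this.symm
  exact hnz M hM0 le_rfl hfM

end Summit.MatrixMultiplication.MatrixMultiplication.Cruxes.TargetsGiveGap.Sketch
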